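import Literature.MathematicalPhysics.KineticTheory.HardSphereEulerClassicalUniqueness
import Literature.MathematicalPhysics.KineticTheory.HardSphereEulerSolutionGluing
import Mathlib.Analysis.SpecialFunctions.SmoothTransition
import HarnessLib

/-!
# Entropy min/max principle for classical hard-sphere Euler solutions (stub `entropyRange`)

Supporting file of the line `Sketch` (card `adiabat-pricing-of-the-ceiling`) for the crux
`AprioriBounds` (stmt-AtomisticToContinuum-14827), proving the registered stub `stub_entropyRange`
of the lead's skeleton VERBATIM: along a CLASSICAL solution `IsHardSphereEulerSolution σ T ρ u θ`
(`HardSphereEuler.lean`) whose packing fraction stays in a chamber `ρσ³ < η₀` on which the excess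
free energy `f_ex = hsExcessFreeEnergy` is `C^∞`, the specific entropy
`s = (3/2) log θ - log ρ - f_ex(ρσ³)` is transported, `∂ₜs + u·∇s = 0` (C. M. Dafermos,
*Hyperbolic Conservation Laws in Continuum Physics*, 2nd ed. 2005, §3.3, eq. (3.3.16): for smooth
flows the entropy production vanishes), hence every value of the cubed adiabat
`A = e^{2s} = θ³ / (ρ² e^{2 f_ex(ρσ³)})` on `[0, t] × 𝕋³`, `t < T`, lies between the minimum and the
maximum of `A(0, ·)` over the compact torus.  The statement is in cubed, cross-multiplied form (no
logarithms, no divisions).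

## Proof

* `hasDerivWithinAt_adiabat` — the one-variable chain rule for `b³/(a² e^{2F(ac)})`;
* `adiabat_balance` — for every smooth `G`, `∂ₜ(ρ G(A)) + Σᵢ ∂ᵢ(ρ G(A) uᵢ) = 0` pointwise, from
  the primitive mass and temperature equations
  (`IsHardSphereEulerSolution.timeDeriv_density_eq`, `.timeDeriv_temperature_eq` of
  `HardSphereEulerPrimitiveForm.lean`, with `ζ r = hsCompressibility (rσ³) = 1 + rσ³ f_ex'(rσ³)`,
  smooth on the open chamber) fed to `linear_combination`;
* `comp_adiabat_eq_zero` — the Grönwall/energy shell `torus_energy_eq_zero_of_balance`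
  (`HardSphereEulerClassicalUniqueness.lean`) for `e = ρ G(A) ≥ 0`, `e(0, ·) = 0`;
* `adiabat_range` — `G = Real.smoothTransition (m₀ - ·)` resp. `(· - M₀)` with `m₀, M₀` the
  extrema of `A(0, ·)` (`IsCompact.exists_isMinOn`);
* `exists_chamber_extension` — the closed-slab chamber hypothesis extends to `[0, t')`, `t' > t`
  (tube lemma `IsSmoothSpaceTimeOn.eventually_norm_sub_lt`), and the solution restricts
  (`IsHardSphereEulerSolution.restrict`, `HardSphereEulerSolutionGluing.lean`).

No new definitions, no named facts; axioms `propext`, `Classical.choice`, `Quot.sound`.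
-/

noncomputable section

open MeasureTheory Filter Set Topology
open scoped ENNReal ContDiff

namespace Summit.AtomisticToContinuum.HydrodynamicLimit.Theorems.AdiabatCeiling

open Literature.MathematicalPhysics.KineticTheory Literature.Analysis.FluidPDE
open Literature.Analysis.FunctionSpaces
open Literature.MathematicalPhysics.KineticTheory.HsEulerCalc

/-- One-variable chain rule for the cubed adiabat `b³ / (a² e^{2F(ac)})` along a curve
`τ ↦ (a τ, b τ)` (time slice or coordinate line): its derivative is
`3b²/(a²P) b' - 2b³(1 + acF')/(a³P) a'`, `P = e^{2F(ac)}`. -/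
theorem hasDerivWithinAt_adiabat {a b F : ℝ → ℝ} {a' b' F' c t a₀ b₀ : ℝ} {s : Set ℝ}
    (ha : HasDerivWithinAt a a' s t) (hb : HasDerivWithinAt b b' s t) (hat : a t = a₀)
    (hbt : b t = b₀) (hF : HasDerivAt F F' (a₀ * c)) (ha0 : a₀ ≠ 0) :
    HasDerivWithinAt (fun τ => b τ ^ 3 / (a τ ^ 2 * Real.exp (2 * F (a τ * c))))
      (3 * b₀ ^ 2 / (a₀ ^ 2 * Real.exp (2 * F (a₀ * c))) * b' -
        2 * b₀ ^ 3 * (1 + a₀ * c * F') / (a₀ ^ 3 * Real.exp (2 * F (a₀ * c))) * a') s t := by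
  subst hat hbt
  have hFa : HasDerivWithinAt (fun τ => F (a τ * c)) (F' * (a' * c)) s t :=
    hF.comp_hasDerivWithinAt t (ha.mul_const c)
  have hden : a t ^ 2 * Real.exp (2 * F (a t * c)) ≠ 0 :=
    mul_ne_zero (pow_ne_zero 2 ha0) (Real.exp_pos _).ne'
  have h := (hb.fun_pow 3).fun_div ((ha.fun_pow 2).fun_mul (hFa.const_mul 2).exp) hden
  refine h.congr_deriv ?_
  have hP : Real.exp (2 * F (a t * c)) ≠ 0 := (Real.exp_pos _).ne'
  field_simp
  ring

variable {σ T η₀ : ℝ} {ρ θ : ℝ → T3 → ℝ} {u : ℝ → T3 → V3}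

/-- Along a classical solution in the chamber `ρσ³ < η₀` (where `f_ex` is smooth), the cubed
adiabat `A = θ³ / (ρ² e^{2 f_ex(ρσ³)})` is jointly smooth on `[0, T) × 𝕋³`. -/
theorem isSmoothSpaceTimeOn_adiabat (hE : IsHardSphereEulerSolution σ T ρ u θ) (hσ : 0 < σ)
    (hF : ContDiffOn ℝ ∞ hsExcessFreeEnergy (Ioo 0 η₀))
    (hch : ∀ s ∈ Ico 0 T, ∀ x, ρ s x * σ ^ 3 < η₀) :
    Torus.IsSmoothSpaceTimeOn (Ico 0 T)
      (fun s y => θ s y ^ 3 / (ρ s y ^ 2 * Real.exp (2 * hsExcessFreeEnergy (ρ s y * σ ^ 3)))) := by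
  have hρσ : Torus.IsSmoothSpaceTimeOn (Ico 0 T) (fun s y => ρ s y * σ ^ 3) :=
    hE.smooth_density.mul (Torus.isSmoothSpaceTimeOn_const (Torus.isSmooth_const _) _)
  have hFρ : Torus.IsSmoothSpaceTimeOn (Ico 0 T)
      (fun s y => hsExcessFreeEnergy (ρ s y * σ ^ 3)) := by
    refine hF.comp hρσ ?_
    rintro ⟨s, v⟩ hp
    exact ⟨mul_pos (hE.density_pos s (mem_prod.1 hp).1 _) (pow_pos hσ 3), hch s (mem_prod.1 hp).1 _⟩
  have h2F : Torus.IsSmoothSpaceTimeOn (Ico 0 T)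
      (fun s y => 2 * hsExcessFreeEnergy (ρ s y * σ ^ 3)) :=
    (Torus.isSmoothSpaceTimeOn_const (Torus.isSmooth_const _) _).mul hFρ
  refine ContDiffOn.div (hE.smooth_temperature.pow 3) ((hE.smooth_density.pow 2).mul h2F.exp) ?_
  rintro ⟨s, v⟩ hp
  exact mul_ne_zero (pow_ne_zero 2 (hE.density_pos s (mem_prod.1 hp).1 _).ne') (Real.exp_pos _).ne'

/-- **Transport of the adiabat, in balance form.** For every smooth `G : ℝ → ℝ` the density
`e = ρ G(A)` and fluxes `Φᵢ = ρ G(A) uᵢ` satisfy `∂ₜe + Σᵢ ∂ᵢΦᵢ = 0` pointwise on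
`[0, T) × 𝕋³`: `= G(A)(∂ₜρ + div(ρu)) + ρ G'(A)(∂ₜA + u·∇A)` and the adiabat is transported,
`∂ₜA + u·∇A = A (3(∂ₜθ + u·∇θ)/θ - 2Z(∂ₜρ + u·∇ρ)/ρ) = A(-2Z div u + 2Z div u) = 0` by the
primitive mass and temperature equations (`Z = hsCompressibility (ρσ³) = 1 + ρσ³ f_ex'(ρσ³)`). -/
theorem adiabat_balance (hE : IsHardSphereEulerSolution σ T ρ u θ) (hσ : 0 < σ)
    (hF : ContDiffOn ℝ ∞ hsExcessFreeEnergy (Ioo 0 η₀))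
    (hch : ∀ s ∈ Ico 0 T, ∀ x, ρ s x * σ ^ 3 < η₀) {G : ℝ → ℝ} (hG : ContDiff ℝ ∞ G)
    {A : ℝ → T3 → ℝ}
    (hA : A = fun s y => θ s y ^ 3 / (ρ s y ^ 2 * Real.exp (2 * hsExcessFreeEnergy (ρ s y * σ ^ 3))))
    {t : ℝ} (ht : t ∈ Ico 0 T) (x : T3) :
    Torus.timeDerivWithin (Ico 0 T) (fun s y => ρ s y * G (A s y)) t x +
      ∑ i, Torus.partialDeriv i (fun y => ρ t y * G (A t y) * u t y i) x = 0 := by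
  have hU : UniqueDiffOn ℝ (Ico (0 : ℝ) T) := uniqueDiffOn_Ico 0 T
  have hσ3 : 0 < σ ^ 3 := pow_pos hσ 3
  -- the rescaled compressibility law `ζ r = Z(rσ³)` on `J = {r | rσ³ ∈ (0, η₀)}`
  have hJ : IsOpen ((fun r : ℝ => r * σ ^ 3) ⁻¹' Ioo 0 η₀) :=
    isOpen_Ioo.preimage (continuous_id.mul continuous_const)
  have hζ : ContDiffOn ℝ ∞ (fun r => hsCompressibility (r * σ ^ 3))
      ((fun r : ℝ => r * σ ^ 3) ⁻¹' Ioo 0 η₀) := by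
    unfold hsCompressibility
    exact contDiffOn_const.add ((contDiffOn_id.mul contDiffOn_const).mul
      ((hF.deriv_of_isOpen isOpen_Ioo le_rfl).comp (contDiffOn_id.mul contDiffOn_const)
        fun r hr => hr))
  have hρJ : ∀ s ∈ Ico 0 T, ∀ y, ρ s y ∈ (fun r : ℝ => r * σ ^ 3) ⁻¹' Ioo 0 η₀ :=
    fun s hs y => ⟨mul_pos (hE.density_pos s hs y) hσ3, hch s hs y⟩
  have hp : ∀ s ∈ Ico 0 T, ∀ y, hsPressure σ (ρ s y) (θ s y) =
      ρ s y * θ s y * (fun r => hsCompressibility (r * σ ^ 3)) (ρ s y) := fun _ _ _ => rfl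
  -- smooth slices
  have hρ1 : Torus.IsContDiff 1 (ρ t) := (hE.smooth_density.isSmooth_slice ht).isContDiff (by simp)
  have hθ1 : Torus.IsContDiff 1 (θ t) :=
    (hE.smooth_temperature.isSmooth_slice ht).isContDiff (by simp)
  have hu1 : Torus.IsContDiff 1 (u t) := (hE.smooth_velocity.isSmooth_slice ht).isContDiff (by simp)
  have huj1 : ∀ i, Torus.IsContDiff 1 (fun y => u t y i) := fun i => isContDiff_apply_coord hu1 i
  have hρ0 : ρ t x ≠ 0 := (hE.density_pos t ht x).ne'
  have hθ0 : θ t x ≠ 0 := (hE.temperature_pos t ht x).ne'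
  -- `f_ex` is differentiable at `ρσ³`, `G` everywhere
  have hmem : ρ t x * σ ^ 3 ∈ Ioo 0 η₀ := hρJ t ht x
  have hFd : HasDerivAt hsExcessFreeEnergy (deriv hsExcessFreeEnergy (ρ t x * σ ^ 3))
      (ρ t x * σ ^ 3) :=
    ((hF.differentiableOn (by simp)).differentiableAt (isOpen_Ioo.mem_nhds hmem)).hasDerivAt
  have hGd : ∀ r, HasDerivAt G (deriv G r) r := fun r =>
    ((hG.differentiable (by simp)) r).hasDerivAt
  -- time-slice derivatives
  have sρ := hE.smooth_density.hasDerivWithinAt_slice ht x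
  have sθ := hE.smooth_temperature.hasDerivWithinAt_slice ht x
  have sA : HasDerivWithinAt (fun τ => A τ x)
      (3 * θ t x ^ 2 / (ρ t x ^ 2 * Real.exp (2 * hsExcessFreeEnergy (ρ t x * σ ^ 3))) *
          Torus.timeDerivWithin (Ico 0 T) θ t x -
        2 * θ t x ^ 3 * (1 + ρ t x * σ ^ 3 * deriv hsExcessFreeEnergy (ρ t x * σ ^ 3)) /
            (ρ t x ^ 3 * Real.exp (2 * hsExcessFreeEnergy (ρ t x * σ ^ 3))) *
          Torus.timeDerivWithin (Ico 0 T) ρ t x) (Ico 0 T) t := by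
    rw [hA]
    exact hasDerivWithinAt_adiabat sρ sθ rfl rfl hFd hρ0
  -- coordinate-line derivatives
  have lρ := fun i => hasDerivAt_coordLine hρ1 x i
  have lθ := fun i => hasDerivAt_coordLine hθ1 x i
  have lu := fun i k => hasDerivAt_coordLine (huj1 k) x i
  have lA : ∀ i, HasDerivAt
      (fun s : ℝ => A t (x + Torus.proj (s • EuclideanSpace.single i (1 : ℝ))))
      (3 * θ t x ^ 2 / (ρ t x ^ 2 * Real.exp (2 * hsExcessFreeEnergy (ρ t x * σ ^ 3))) *
          Torus.partialDeriv i (θ t) x -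
        2 * θ t x ^ 3 * (1 + ρ t x * σ ^ 3 * deriv hsExcessFreeEnergy (ρ t x * σ ^ 3)) /
            (ρ t x ^ 3 * Real.exp (2 * hsExcessFreeEnergy (ρ t x * σ ^ 3))) *
          Torus.partialDeriv i (ρ t) x) 0 := by
    intro i
    rw [hA]
    have h := hasDerivWithinAt_adiabat (s := univ) (a₀ := ρ t x) (b₀ := θ t x) (lρ i).hasDerivWithinAt
      (lθ i).hasDerivWithinAt (by simp only [zero_smul, Torus.proj_zero, add_zero])
      (by simp only [zero_smul, Torus.proj_zero, add_zero]) hFd hρ0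
    exact hasDerivWithinAt_univ.1 h
  -- (1) `∂ₜ(ρ G(A))`
  have h1 : Torus.timeDerivWithin (Ico 0 T) (fun s y => ρ s y * G (A s y)) t x =
      Torus.timeDerivWithin (Ico 0 T) ρ t x * G (A t x) + ρ t x * (deriv G (A t x) *
        (3 * θ t x ^ 2 / (ρ t x ^ 2 * Real.exp (2 * hsExcessFreeEnergy (ρ t x * σ ^ 3))) *
            Torus.timeDerivWithin (Ico 0 T) θ t x -
          2 * θ t x ^ 3 * (1 + ρ t x * σ ^ 3 * deriv hsExcessFreeEnergy (ρ t x * σ ^ 3)) /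
              (ρ t x ^ 3 * Real.exp (2 * hsExcessFreeEnergy (ρ t x * σ ^ 3))) *
            Torus.timeDerivWithin (Ico 0 T) ρ t x)) :=
    timeDerivWithin_eq_of_hasDerivWithinAt (sρ.fun_mul ((hGd _).comp_hasDerivWithinAt t sA))
      (hU t ht)
  -- (2) `∂ᵢ(ρ G(A) uᵢ)`
  have h2 : ∀ i, Torus.partialDeriv i (fun y => ρ t y * G (A t y) * u t y i) x =
      (Torus.partialDeriv i (ρ t) x * G (A t x) + ρ t x * (deriv G (A t x) *
        (3 * θ t x ^ 2 / (ρ t x ^ 2 * Real.exp (2 * hsExcessFreeEnergy (ρ t x * σ ^ 3))) *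
            Torus.partialDeriv i (θ t) x -
          2 * θ t x ^ 3 * (1 + ρ t x * σ ^ 3 * deriv hsExcessFreeEnergy (ρ t x * σ ^ 3)) /
              (ρ t x ^ 3 * Real.exp (2 * hsExcessFreeEnergy (ρ t x * σ ^ 3))) *
            Torus.partialDeriv i (ρ t) x))) * u t x i +
        ρ t x * G (A t x) * Torus.partialDeriv i (fun y => u t y i) x := by
    intro i
    exact partialDeriv_eq_of_hasDerivAt ((((lρ i).fun_mul ((hGd _).comp 0 (lA i))).fun_mul
      (lu i i)).congr_deriv (by simp only [zero_smul, Torus.proj_zero, add_zero, Function.comp]))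
  -- (3) the primitive equations and the algebra
  have hP1 := hE.timeDeriv_density_eq ht x
  have hP3 := hE.timeDeriv_temperature_eq hJ hζ hρJ hp ht x
  have hkey : 2 / 3 * (θ t x * hsCompressibility (ρ t x * σ ^ 3)) *
      (3 * θ t x ^ 2 / (ρ t x ^ 2 * Real.exp (2 * hsExcessFreeEnergy (ρ t x * σ ^ 3)))) -
      ρ t x * (2 * θ t x ^ 3 * (1 + ρ t x * σ ^ 3 * deriv hsExcessFreeEnergy (ρ t x * σ ^ 3)) /
        (ρ t x ^ 3 * Real.exp (2 * hsExcessFreeEnergy (ρ t x * σ ^ 3)))) = 0 := by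
    unfold hsCompressibility
    have hP : Real.exp (2 * hsExcessFreeEnergy (ρ t x * σ ^ 3)) ≠ 0 := (Real.exp_pos _).ne'
    field_simp
    ring
  rw [h1]
  simp only [h2]
  simp only [Fin.sum_univ_three] at hP1 hP3 ⊢
  linear_combination (G (A t x) - ρ t x * deriv G (A t x) *
      (2 * θ t x ^ 3 * (1 + ρ t x * σ ^ 3 * deriv hsExcessFreeEnergy (ρ t x * σ ^ 3)) /
        (ρ t x ^ 3 * Real.exp (2 * hsExcessFreeEnergy (ρ t x * σ ^ 3))))) * hP1 +
    (ρ t x * deriv G (A t x) *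
      (3 * θ t x ^ 2 / (ρ t x ^ 2 * Real.exp (2 * hsExcessFreeEnergy (ρ t x * σ ^ 3))))) * hP3 -
    (ρ t x * deriv G (A t x) * (Torus.partialDeriv 0 (fun y => u t y 0) x +
      Torus.partialDeriv 1 (fun y => u t y 1) x + Torus.partialDeriv 2 (fun y => u t y 2) x)) * hkey

/-- **Conserved functionals of the adiabat vanish if they vanish initially.** For smooth
`G ≥ 0` with `G(A(0, ·)) = 0`, the energy shell `torus_energy_eq_zero_of_balance` applied to
`e = ρ G(A)`, `Φᵢ = ρ G(A) uᵢ` (balance `= 0 ≤ 0 · e` by `adiabat_balance`) gives `ρ G(A) ≡ 0`,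
hence `G(A) ≡ 0` on `[0, T) × 𝕋³` (`ρ > 0`). -/
theorem comp_adiabat_eq_zero (hE : IsHardSphereEulerSolution σ T ρ u θ) (hσ : 0 < σ)
    (hF : ContDiffOn ℝ ∞ hsExcessFreeEnergy (Ioo 0 η₀))
    (hch : ∀ s ∈ Ico 0 T, ∀ x, ρ s x * σ ^ 3 < η₀) {G : ℝ → ℝ} (hG : ContDiff ℝ ∞ G)
    (hG0 : ∀ r, 0 ≤ G r) {A : ℝ → T3 → ℝ}
    (hA : A = fun s y => θ s y ^ 3 / (ρ s y ^ 2 * Real.exp (2 * hsExcessFreeEnergy (ρ s y * σ ^ 3))))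
    (hinit : ∀ y, G (A 0 y) = 0) : ∀ s ∈ Ico 0 T, ∀ x, G (A s x) = 0 := by
  have hAs : Torus.IsSmoothSpaceTimeOn (Ico 0 T) A := hA ▸ isSmoothSpaceTimeOn_adiabat hE hσ hF hch
  have hGA : Torus.IsSmoothSpaceTimeOn (Ico 0 T) (fun s y => G (A s y)) := hG.comp_contDiffOn hAs
  have he : Torus.IsSmoothSpaceTimeOn (Ico 0 T) (fun s y => ρ s y * G (A s y)) :=
    hE.smooth_density.mul hGA
  have hΦ : ∀ i, Torus.IsSmoothSpaceTimeOn (Ico 0 T) (fun s y => ρ s y * G (A s y) * u s y i) :=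
    fun i => he.mul (hE.smooth_velocity.apply i)
  have hzero := torus_energy_eq_zero_of_balance (e := fun s y => ρ s y * G (A s y))
    (Φ := fun i s y => ρ s y * G (A s y) * u s y i) he hΦ
    (fun t ht x => mul_nonneg (hE.density_pos t ht x).le (hG0 _))
    (fun x => by simp [hinit x])
    (fun t₁ ht₁ => ⟨0, fun t ht x => by
      rw [zero_mul]
      exact (adiabat_balance hE hσ hF hch hG hA ⟨ht.1, ht.2.trans_lt ht₁.2⟩ x).le⟩)
  intro s hs x
  exact (mul_eq_zero.1 (hzero s hs x)).resolve_left (hE.density_pos s hs x).ne'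

/-- **Range of the adiabat.** Along a classical solution in the chamber, every value `A(s, x)`,
`s ∈ [0, T)`, lies between the minimum and the maximum of `A(0, ·)` over the (compact) torus:
apply `comp_adiabat_eq_zero` to `G = smoothTransition (m₀ - ·)` and `smoothTransition (· - M₀)`
(smooth, nonnegative, vanishing exactly on the nonpositive reals). -/
theorem adiabat_range (hE : IsHardSphereEulerSolution σ T ρ u θ) (hσ : 0 < σ)
    (hF : ContDiffOn ℝ ∞ hsExcessFreeEnergy (Ioo 0 η₀))
    (hch : ∀ s ∈ Ico 0 T, ∀ x, ρ s x * σ ^ 3 < η₀) {A : ℝ → T3 → ℝ}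
    (hA : A = fun s y => θ s y ^ 3 / (ρ s y ^ 2 * Real.exp (2 * hsExcessFreeEnergy (ρ s y * σ ^ 3))))
    {s : ℝ} (hs : s ∈ Ico 0 T) (x : T3) : (∃ y, A 0 y ≤ A s x) ∧ (∃ y, A s x ≤ A 0 y) := by
  have h0 : (0 : ℝ) ∈ Ico 0 T := ⟨le_rfl, hs.1.trans_lt hs.2⟩
  have hAs : Torus.IsSmoothSpaceTimeOn (Ico 0 T) A := hA ▸ isSmoothSpaceTimeOn_adiabat hE hσ hF hch
  have hc : Continuous (A 0) := (hAs.isSmooth_slice h0).continuous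
  obtain ⟨y₀, -, hy₀⟩ := isCompact_univ.exists_isMinOn univ_nonempty hc.continuousOn
  obtain ⟨y₁, -, hy₁⟩ := isCompact_univ.exists_isMaxOn univ_nonempty hc.continuousOn
  refine ⟨⟨y₀, ?_⟩, ⟨y₁, ?_⟩⟩
  · have hG : ContDiff ℝ ∞ (fun r => Real.smoothTransition (A 0 y₀ - r)) :=
      Real.smoothTransition.contDiff.comp (contDiff_const.sub contDiff_id)
    have h := comp_adiabat_eq_zero hE hσ hF hch hG (fun r => Real.smoothTransition.nonneg _) hA
      (fun y => Real.smoothTransition.zero_of_nonpos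
        (sub_nonpos.2 (isMinOn_iff.mp hy₀ y (mem_univ y)))) s hs x
    by_contra hlt
    exact (Real.smoothTransition.pos_of_pos (sub_pos.2 (not_le.mp hlt))).ne' h
  · have hG : ContDiff ℝ ∞ (fun r => Real.smoothTransition (r - A 0 y₁)) :=
      Real.smoothTransition.contDiff.comp (contDiff_id.sub contDiff_const)
    have h := comp_adiabat_eq_zero hE hσ hF hch hG (fun r => Real.smoothTransition.nonneg _) hA
      (fun y => Real.smoothTransition.zero_of_nonpos
        (sub_nonpos.2 (isMaxOn_iff.mp hy₁ y (mem_univ y)))) s hs x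
    by_contra hlt
    exact (Real.smoothTransition.pos_of_pos (sub_pos.2 (not_le.mp hlt))).ne' h

/-- Cross-multiplication of an adiabat inequality (all data positive), lower form:
`θa³/(ρa² e^{2fa}) ≤ θb³/(ρb² e^{2fb})` gives `θa³ ρb² e^{2(fb - fa)} ≤ θb³ ρa²`. -/
theorem cross_mul_le_of_adiabat_le {θa ρa fa θb ρb fb : ℝ} (hρa : 0 < ρa) (hρb : 0 < ρb)
    (h : θa ^ 3 / (ρa ^ 2 * Real.exp (2 * fa)) ≤ θb ^ 3 / (ρb ^ 2 * Real.exp (2 * fb))) :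
    θa ^ 3 * ρb ^ 2 * Real.exp (2 * (fb - fa)) ≤ θb ^ 3 * ρa ^ 2 := by
  have hPa := Real.exp_pos (2 * fa)
  have hPb := Real.exp_pos (2 * fb)
  rw [div_le_div_iff₀ (by positivity) (by positivity)] at h
  rw [mul_sub, Real.exp_sub, ← mul_div_assoc, div_le_iff₀ hPa]
  calc θa ^ 3 * ρb ^ 2 * Real.exp (2 * fb) = θa ^ 3 * (ρb ^ 2 * Real.exp (2 * fb)) := by ring
    _ ≤ θb ^ 3 * (ρa ^ 2 * Real.exp (2 * fa)) := h
    _ = θb ^ 3 * ρa ^ 2 * Real.exp (2 * fa) := by ring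

/-- Cross-multiplication of an adiabat inequality (all data positive), upper form:
`θa³/(ρa² e^{2fa}) ≤ θb³/(ρb² e^{2fb})` gives `θa³ ρb² ≤ θb³ ρa² e^{2(fa - fb)}`. -/
theorem le_cross_mul_of_adiabat_le {θa ρa fa θb ρb fb : ℝ} (hρa : 0 < ρa) (hρb : 0 < ρb)
    (h : θa ^ 3 / (ρa ^ 2 * Real.exp (2 * fa)) ≤ θb ^ 3 / (ρb ^ 2 * Real.exp (2 * fb))) :
    θa ^ 3 * ρb ^ 2 ≤ θb ^ 3 * ρa ^ 2 * Real.exp (2 * (fa - fb)) := by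
  have hPa := Real.exp_pos (2 * fa)
  have hPb := Real.exp_pos (2 * fb)
  rw [div_le_div_iff₀ (by positivity) (by positivity)] at h
  rw [mul_sub, Real.exp_sub, ← mul_div_assoc, le_div_iff₀ hPb]
  calc θa ^ 3 * ρb ^ 2 * Real.exp (2 * fb) = θa ^ 3 * (ρb ^ 2 * Real.exp (2 * fb)) := by ring
    _ ≤ θb ^ 3 * (ρa ^ 2 * Real.exp (2 * fa)) := h
    _ = θb ^ 3 * ρa ^ 2 * Real.exp (2 * fa) := by ring

/-- **Extension of the chamber past a closed time slab.** If `ρσ³ < η₀` on `[0, t] × 𝕋³`,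
`0 ≤ t < T`, then `ρσ³ < η₀` on `[0, t') × 𝕋³` for some `t' ∈ (t, T]`: the slice `ρ(t, ·)`
attains its maximum on the compact torus, strictly inside the chamber, and `ρ(s, ·) → ρ(t, ·)`
uniformly as `s → t` (tube lemma `IsSmoothSpaceTimeOn.eventually_norm_sub_lt`). -/
theorem exists_chamber_extension (hE : IsHardSphereEulerSolution σ T ρ u θ) (hσ : 0 < σ)
    {t : ℝ} (ht0 : 0 ≤ t) (htT : t < T) (hch : ∀ s ∈ Icc 0 t, ∀ x, ρ s x * σ ^ 3 < η₀) :
    ∃ t', t < t' ∧ t' ≤ T ∧ ∀ s ∈ Ico 0 t', ∀ x, ρ s x * σ ^ 3 < η₀ := by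
  have htS : t ∈ Ico 0 T := ⟨ht0, htT⟩
  have hσ3 : 0 < σ ^ 3 := pow_pos hσ 3
  have hc : Continuous (ρ t) := (hE.smooth_density.isSmooth_slice htS).continuous
  obtain ⟨xM, -, hxM⟩ := isCompact_univ.exists_isMaxOn univ_nonempty hc.continuousOn
  have hεpos : 0 < η₀ - ρ t xM * σ ^ 3 := sub_pos.2 (hch t ⟨ht0, le_rfl⟩ xM)
  have hev := hE.smooth_density.eventually_norm_sub_lt htS (ε := (η₀ - ρ t xM * σ ^ 3) / σ ^ 3)
    (div_pos hεpos hσ3)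
  rw [eventually_nhdsWithin_iff] at hev
  obtain ⟨δ, hδ, hδP⟩ := Metric.eventually_nhds_iff.1 hev
  refine ⟨min (t + δ) T, lt_min (by linarith) htT, min_le_right _ _, fun s hs x => ?_⟩
  rcases le_or_gt s t with hst | hst
  · exact hch s ⟨hs.1, hst⟩ x
  · have hsT : s ∈ Ico 0 T := ⟨hs.1, (lt_min_iff.1 hs.2).2⟩
    have hsδ : dist s t < δ := by
      rw [Real.dist_eq, abs_of_pos (sub_pos.2 hst)]
      linarith [(lt_min_iff.1 hs.2).1]
    have h1 := hδP hsδ hsT x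
    rw [Real.norm_eq_abs] at h1
    have h2 : ρ s x - ρ t x < (η₀ - ρ t xM * σ ^ 3) / σ ^ 3 := (le_abs_self _).trans_lt h1
    have h3 : ρ t x ≤ ρ t xM := isMaxOn_iff.mp hxM x (mem_univ x)
    have h4 : (ρ s x - ρ t x) * σ ^ 3 < η₀ - ρ t xM * σ ^ 3 := by
      have h5 := mul_lt_mul_of_pos_right h2 hσ3
      rwa [div_mul_cancel₀ _ hσ3.ne'] at h5
    nlinarith [mul_le_mul_of_nonneg_right h3 hσ3.le]

/-- STUB `entropyRange` of the line `Sketch` (crux `AprioriBounds`, stmt-AtomisticToContinuum-14827):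
the specific entropy `s = (3/2)log θ − log ρ − f_ex(ρσ³)` of a CLASSICAL hard-sphere Euler solution
is transported (`∂ₜs + u·∇s = 0`, Dafermos 2005 §3.3) as long as the equation of state is smooth
along the range of `ρσ³`; hence on `[0, t]`, `t < T`, every value of the cubed adiabat
`A = e^{2s} = θ³/(ρ² e^{2f_ex(ρσ³)})` lies between two INITIAL values (cubed, cross-multiplied
form).  Proof: extend the chamber slightly past `t` (`exists_chamber_extension`), restrict the
solution (`IsHardSphereEulerSolution.restrict`), and apply the entropy min/max principle
`adiabat_range` (energy shell `torus_energy_eq_zero_of_balance` for `ρ G(A)`). -/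
theorem stub_entropyRange :
    ∀ (σ T η₀ : ℝ) (ρ θ : ℝ → T3 → ℝ) (u : ℝ → T3 → V3), 0 < σ → 0 < η₀ →
      ContDiffOn ℝ ∞ hsExcessFreeEnergy (Set.Ioo 0 η₀) →
      IsHardSphereEulerSolution σ T ρ u θ →
      ∀ t : ℝ, 0 ≤ t → t < T → (∀ s ∈ Icc 0 t, ∀ x, ρ s x * σ ^ 3 < η₀) →
        ∀ s ∈ Icc 0 t, ∀ x : T3,
          (∃ y : T3, θ 0 y ^ 3 * ρ s x ^ 2 *
              Real.exp (2 * (hsExcessFreeEnergy (ρ s x * σ ^ 3) - hsExcessFreeEnergy (ρ 0 y * σ ^ 3))) ≤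
            θ s x ^ 3 * ρ 0 y ^ 2) ∧
          (∃ y : T3, θ s x ^ 3 * ρ 0 y ^ 2 ≤
            θ 0 y ^ 3 * ρ s x ^ 2 *
              Real.exp (2 * (hsExcessFreeEnergy (ρ s x * σ ^ 3) - hsExcessFreeEnergy (ρ 0 y * σ ^ 3)))) := by
  intro σ T η₀ ρ θ u hσ _hη₀ hF hE t ht0 htT hch s hs x
  obtain ⟨t', htt', ht'T, hch'⟩ := exists_chamber_extension hE hσ ht0 htT hch
  have hE' : IsHardSphereEulerSolution σ t' ρ u θ := hE.restrict ht'T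
  obtain ⟨A, hA⟩ : ∃ A : ℝ → T3 → ℝ, A = fun s y =>
      θ s y ^ 3 / (ρ s y ^ 2 * Real.exp (2 * hsExcessFreeEnergy (ρ s y * σ ^ 3))) := ⟨_, rfl⟩
  have hs' : s ∈ Ico 0 t' := ⟨hs.1, hs.2.trans_lt htt'⟩
  have h0' : (0 : ℝ) ∈ Ico 0 t' := ⟨le_rfl, ht0.trans_lt htt'⟩
  obtain ⟨⟨y₀, hy₀⟩, ⟨y₁, hy₁⟩⟩ := adiabat_range hE' hσ hF hch' hA hs' x
  rw [hA] at hy₀ hy₁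
  exact ⟨⟨y₀, cross_mul_le_of_adiabat_le (hE'.density_pos 0 h0' y₀) (hE'.density_pos s hs' x) hy₀⟩,
    ⟨y₁, le_cross_mul_of_adiabat_le (hE'.density_pos s hs' x) (hE'.density_pos 0 h0' y₁) hy₁⟩⟩

end Summit.AtomisticToContinuum.HydrodynamicLimit.Theorems.AdiabatCeiling

end
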